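import Summits.QuantumFields.YangMills.Theorems.BalabanUVNodesN15KingModelLandauFlux
import Summits.QuantumFields.YangMills.Theorems.BalabanUVNodesN15KingModelLandauTent
import Summits.QuantumFields.YangMills.Theorems.BalabanUVNodesN15KingModelCurvatureHarper
import Literature.LinearAlgebra.Matrix.RayleighQuotient
import HarnessLib

/-!
# BalabanUVNodes ∕ N15 — THE KING-MODEL RUNG (PART Ϡ-g): THE LANDAU SCALING IS TWO-SIDED — a tent trial state of width `ℓ` along `ν₀` gives an eigenvalue of `−cΔ_U+m²` at the
# constant-flux field below `m² + c(9∕ℓ² + θ²ℓ²)`, hence (`ℓ ≍ θ^{−1∕2}`) below `m² + 13c|θ|` for `0 < |θ| ≤ 1`: together with PART Ϡ-c, `c|θ|∕4 ≤ λ_min(−cΔ_U+m²) − m² ≤ 13c|θ|` —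
# the bottom of King's covariant kinetic spectrum at constant curvature is LINEAR in the flux angle, on both sides
# (Track A, DAG node N15 = NE2; FAN-OUT v1.1 §N15 s3 «KING-MODEL RUNG … + what the curved case adds»; count-neutral)

HONEST FRAMING.  Count-neutral (cell `pub-ymgap`, seat `pub-ymgap-dag-n15-e` g47; `--supports stmt-QuantumFields-27247 --as helper` = K3ᴬ, KEY MAP v3).  A variational upper bound
(Rayleigh quotient of an explicit trial vector; the tree's `Literature.LinearAlgebra.Matrix.RayleighQuotient`, [HornJohnson2013] Thm 4.2.2) for King's covariant fine operator
([King1986] (4.4) p.670; [Balaban1985BackgroundPropagators] (3.23) p.394) at the constant-flux field of PART Ͻ-q with flux momentum supported on `ν₀` (PART Ϳ-n's Harper setting).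
One finite torus at fixed spacing; `U(1)`; NOT Bałaban's `G_k(U)`; NOT a node discharge; nothing continuum ∕ ℝ⁴ ∕ OS ∕ Clay.

THE RESULTS (`N = K_{ν₀}`, `p = p₀·e_{ν₀}`, `θ = p′_{ν₀}`, `ψ = stdAddChar`):
* §1–§2 (the cycle distance `cycD`, the Harper potential bound `2 − 2Re ψ(p₀j) ≤ θ²cycD(j)²`, the tent profile and its mass ∕ kinetic ∕ potential budgets) are PART Ϡ-f
  `…LandauTent` (split for the 400-line rule), used BY NAME.
* §3 THE PROFILE REDUCTION (any real profile `g : ℤ∕N → ℝ`, `v(x) = g(x_{ν₀})`): `sum_comp_coord` (`N·Σ_xF(x_{ν₀}) = |T|·Σ_jF(j)`), ★★ `re_quadForm_covLapF_fluxLink_profile` (the form of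
  the profile state is `m²Σg² + c(Σ|∇g|² + Σ(2−2Re ψ(p₀j))g²)` per `ν₀`-line), ★★ **`exists_eigenvalue_le_of_profile`** (`∃ i, λ_i ≤ m² + c·(Σ|∇g|² + ΣVg²)∕Σg²`).
* §4 ★★★ **`exists_eigenvalue_covLapF_fluxLink_le_tent`** (`1 ≤ ℓ ≤ N∕2`: `∃ i, λ_i ≤ m² + c(9∕ℓ² + θ²ℓ²)`), `exists_nat_sq_window` (`0 < θ ≤ 1`, `θ ≥ 2π∕N`-type size ⟹ an
  admissible `ℓ` with `1∕θ ≤ ℓ² ≤ 4∕θ`), ★★★ **`exists_eigenvalue_covLapF_fluxLink_le_linear`** (`0 < |θ| ≤ 1`, `N ≥ 16`… see statement: `∃ i, λ_i ≤ m² + 13c|θ|`), ★★★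
  **`landau_two_sided`** (`∀ i, m² + c|θ|∕4 ≤ λ_i` ∧ `∃ i, λ_i ≤ m² + 13c|θ|` — THE LANDAU SCALING, both sides linear in the flux).
PRIOR TREE ART (by name): Ϡ-f (`cycD`, `tent`, `sum_tent_sq_ge`, `sum_tent_fwdDiff_sq_le`, `sum_potential_tent_sq_le`, `two_sub_two_re_stdAddChar_le`), Ϡ-a (`landauGap_ge_quarter`, `norm_sq_one_sub_of_norm_eq_one`), Ϡ-b (`sum_sum_add_single`), Ϡ-c (`eigenvalues_covLapF_fluxLink_ge_quarter`, `norm_fib_unit`, `covDiff_fluxLink_of_ne`, `covDiff_fluxLink_same`),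
Ͱ-a∕b∕d (`covLapF`, `fib`, `isHermitian_covLapF`, `re_quadForm_covLapF`), Ϳ-n (`chi_eq_stdAddChar_of_supported`), Ͻ-q (`fluxLink`, `fluxLink_mem_unitaryGroup`), `B5Prop11Plancherel` (`chi`, `chi_unitVec`,
`sOf`), `King1986.Torus.chi_unitVec_eq_exp`, `Literature.LinearAlgebra.Matrix.RayleighQuotient.exists_eigenvalues_le_and_ge_re_form_div` ([HornJohnson2013] 4.2.2), Mathlib (`ZMod.valMinAbs`,
`ZMod.natAbs_valMinAbs_add_le`, `ZMod.natAbs_valMinAbs_neg`, `ZMod.valMinAbs_natCast_of_le_half`, `ZMod.coe_valMinAbs`, `AddChar.map_zsmul_eq_zpow`, `Complex.exp_int_mul`, `Finset.sum_range_reflect`).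
Dedup (rg at filing): basename 0 files; needles `cycD|tent_|sum_comp_coord|_profile|_le_tent|landau_two_sided` checked.  Locators: [King1986] (4.4) p.670, (2.12) p.653; [HornJohnson2013] Thm 4.2.2
p.234 (Rayleigh); [Balaban1985BackgroundPropagators] (3.23) p.394; Landau levels (notion).  0 `sorry`, 0 `def`.
-/

noncomputable section
open scoped BigOperators ComplexConjugate ComplexOrder
open Finset Matrix WithLp

namespace Summit.QuantumFields.YangMills.BalabanUVNodes.N15KingModelRung.Landau

open Literature.MathematicalPhysics.QuantumFieldTheory.Balaban1983to89.B5Prop11Plancherel (Tor unitVec chi chi_unitVec sOf)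
open Literature.MathematicalPhysics.QuantumFieldTheory.King1986.Torus (chi_unitVec_eq_exp)
open Summit.QuantumFields.YangMills.BalabanUVNodes.N15KingModelRung.Covariant (covLapF fib fib_apply isHermitian_covLapF re_quadForm_covLapF)
open Summit.QuantumFields.YangMills.BalabanUVNodes.N15KingModelRung.Cover (fluxLink fluxLink_mem_unitaryGroup)
open Summit.QuantumFields.YangMills.BalabanUVNodes.N15KingModelRung.Curvature (chi_eq_stdAddChar_of_supported)

/-! ## §3 The profile reduction on the torus -/

section Profile

variable {d : ℕ} (K : Fin (d + 1) → ℕ) [hK : ∀ μ, NeZero (K μ)]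

/-- ★ SUMMING A FUNCTION OF ONE COORDINATE: `K_{ν₀}·Σ_x F(x_{ν₀}) = |Tor K|·Σ_{j∈ℤ∕K_{ν₀}} F(j)`. [folklore] -/
theorem sum_comp_coord (ν₀ : Fin (d + 1)) (F : ZMod (K ν₀) → ℝ) :
    (K ν₀ : ℝ) * ∑ x : Tor K, F (x ν₀) = (Fintype.card (Tor K) : ℝ) * ∑ j : ZMod (K ν₀), F j := by
  have h : ∑ x : Tor K, ∑ s : ZMod (K ν₀), (fun y : Tor K => F (y ν₀)) (x + Pi.single ν₀ s) = (K ν₀) • ∑ x : Tor K, F (x ν₀) :=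
    sum_sum_add_single K ν₀ (fun y : Tor K => F (y ν₀))
  have hline : ∀ x : Tor K, ∑ s : ZMod (K ν₀), (fun y : Tor K => F (y ν₀)) (x + Pi.single ν₀ s) = ∑ j : ZMod (K ν₀), F j := fun x => by
    have hco : ∀ s : ZMod (K ν₀), (x + Pi.single ν₀ s : Tor K) ν₀ = x ν₀ + s := fun s => by simp
    simp only [hco]
    exact Fintype.sum_equiv (Equiv.addLeft (x ν₀)) _ _ fun s => rfl
  rw [Finset.sum_congr rfl fun x _ => hline x, Finset.sum_const, Finset.card_univ, nsmul_eq_mul, nsmul_eq_mul] at h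
  linarith

/-- ★★ **THE FORM OF A PROFILE STATE**: for `p` supported on `ν₀ ≠ ν₁`, `U = fluxLink p ν₁` and `v(x) = g(x_{ν₀})` (real profile):
`K_{ν₀}·Re⟨v,(−cΔ_U+m²)v⟩ = |T|·(m²Σ_jg(j)² + c(Σ_j(g(j) − g(j+1))² + Σ_j(2 − 2Re ψ(p₀j))g(j)²))` — only the `ν₀`-differences and the `ν₁` Landau phases survive; the other `d − 1`
directions see a constant. [cite: King1986, (4.4) p.670; Balaban1985BackgroundPropagators, (3.23) p.394] -/
theorem re_quadForm_covLapF_fluxLink_profile (c m2 : ℝ) {p : Tor K} {ν₀ ν₁ : Fin (d + 1)} (hν : ν₀ ≠ ν₁) (hp : ∀ μ, μ ≠ ν₀ → p μ = 0) (g : ZMod (K ν₀) → ℝ) :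
    (K ν₀ : ℝ) * (star (fun z : Tor K × Unit => ((g (z.1 ν₀) : ℝ) : ℂ)) ⬝ᵥ (covLapF K c m2 (fluxLink K p ν₁) *ᵥ fun z : Tor K × Unit => ((g (z.1 ν₀) : ℝ) : ℂ))).re
      = (Fintype.card (Tor K) : ℝ) * (m2 * ∑ j, g j ^ 2
          + c * (∑ j, (g j - g (j + 1)) ^ 2 + ∑ j, (2 - 2 * ((ZMod.stdAddChar (N := K ν₀)) (p ν₀ * j) : ℂ).re) * g j ^ 2)) := by
  set v : Tor K × Unit → ℂ := fun z => ((g (z.1 ν₀) : ℝ) : ℂ) with hv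
  have hre : (star v ⬝ᵥ (covLapF K c m2 (fluxLink K p ν₁) *ᵥ v)).re = RCLike.re (star v ⬝ᵥ (covLapF K c m2 (fluxLink K p ν₁) *ᵥ v)) := rfl
  rw [hre, re_quadForm_covLapF K c m2 (fluxLink_mem_unitaryGroup K p ν₁) v]
  -- the mass term
  have hmass : ∀ x : Tor K, ‖fib K v x‖ ^ 2 = g (x ν₀) ^ 2 := fun x => by
    rw [norm_fib_unit, hv]; simp only []; rw [Complex.norm_real, Real.norm_eq_abs, sq_abs]
  -- the bond terms
  have hcoord : ∀ (x : Tor K) (μ : Fin (d + 1)), (x + unitVec K μ) ν₀ = if μ = ν₀ then x ν₀ + 1 else x ν₀ := fun x μ => by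
    by_cases h : μ = ν₀
    · subst h; simp [unitVec]
    · simp [unitVec, h]
  have hbond0 : ∀ x : Tor K, ‖fib K v x - Matrix.toEuclideanLin (fluxLink K p ν₁ (x, ν₀)) (fib K v (x + unitVec K ν₀))‖ ^ 2 = (g (x ν₀) - g (x ν₀ + 1)) ^ 2 := fun x => by
    rw [covDiff_fluxLink_of_ne K p hν, hv]; simp only []
    rw [hcoord, if_pos rfl, ← Complex.ofReal_sub, Complex.norm_real, Real.norm_eq_abs, sq_abs]
  have hbond1 : ∀ x : Tor K, ‖fib K v x - Matrix.toEuclideanLin (fluxLink K p ν₁ (x, ν₁)) (fib K v (x + unitVec K ν₁))‖ ^ 2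
      = (2 - 2 * ((ZMod.stdAddChar (N := K ν₀)) (p ν₀ * x ν₀) : ℂ).re) * g (x ν₀) ^ 2 := fun x => by
    rw [covDiff_fluxLink_same, hv]; simp only []
    rw [hcoord, if_neg (Ne.symm hν), chi_eq_stdAddChar_of_supported K hp x]
    set ζ : ℂ := (ZMod.stdAddChar (N := K ν₀)) (p ν₀ * x ν₀) with hζ
    have hζ1 : ‖ζ‖ = 1 := by rw [hζ, ZMod.stdAddChar_apply]; exact Circle.norm_coe _
    have : ((g (x ν₀) : ℝ) : ℂ) - ζ * ((g (x ν₀) : ℝ) : ℂ) = (1 - ζ) * ((g (x ν₀) : ℝ) : ℂ) := by ring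
    rw [this, norm_mul, mul_pow, Complex.norm_real, Real.norm_eq_abs, sq_abs, (norm_sq_one_sub_of_norm_eq_one hζ1).1]
  have hbondr : ∀ (x : Tor K) (μ : Fin (d + 1)), μ ≠ ν₀ → μ ≠ ν₁ →
      ‖fib K v x - Matrix.toEuclideanLin (fluxLink K p ν₁ (x, μ)) (fib K v (x + unitVec K μ))‖ ^ 2 = 0 := fun x μ hμ0 hμ1 => by
    rw [covDiff_fluxLink_of_ne K p hμ1, hv]; simp only []
    rw [hcoord, if_neg hμ0, sub_self, norm_zero]; ring
  -- split the direction sum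
  have hsplit : ∀ x : Tor K, ∑ μ, ‖fib K v x - Matrix.toEuclideanLin (fluxLink K p ν₁ (x, μ)) (fib K v (x + unitVec K μ))‖ ^ 2
      = (g (x ν₀) - g (x ν₀ + 1)) ^ 2 + (2 - 2 * ((ZMod.stdAddChar (N := K ν₀)) (p ν₀ * x ν₀) : ℂ).re) * g (x ν₀) ^ 2 := by
    intro x
    rw [← Finset.add_sum_erase _ _ (Finset.mem_univ ν₀), ← Finset.add_sum_erase _ _ (Finset.mem_erase.mpr ⟨Ne.symm hν, Finset.mem_univ ν₁⟩), hbond0, hbond1,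
      Finset.sum_eq_zero fun μ hμ => hbondr x μ (Finset.ne_of_mem_erase (Finset.mem_of_mem_erase hμ)) (Finset.ne_of_mem_erase hμ), add_zero]
  simp_rw [hmass, hsplit]
  have e1 := sum_comp_coord K ν₀ (fun j => g j ^ 2)
  have e2 := sum_comp_coord K ν₀ (fun j => (g j - g (j + 1)) ^ 2 + (2 - 2 * ((ZMod.stdAddChar (N := K ν₀)) (p ν₀ * j) : ℂ).re) * g j ^ 2)
  rw [Finset.sum_add_distrib (f := fun j : ZMod (K ν₀) => (g j - g (j + 1)) ^ 2)] at e2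
  linear_combination m2 * e1 + c * e2

/-- ★★ **THE VARIATIONAL PRINCIPLE FOR PROFILE STATES**: for `p` supported on `ν₀ ≠ ν₁` and any real profile `g` with `Σg² > 0`, some eigenvalue of `−cΔ_U+m²` at `U = fluxLink p ν₁` is
`≤ m² + c·(Σ_j(g(j)−g(j+1))² + Σ_j(2 − 2Re ψ(p₀j))g(j)²)∕Σ_jg(j)²` (Rayleigh, [HornJohnson2013] Thm 4.2.2). [cite: HornJohnson2013, Thm 4.2.2; King1986, (4.4) p.670] -/
theorem exists_eigenvalue_le_of_profile (c m2 : ℝ) {p : Tor K} {ν₀ ν₁ : Fin (d + 1)} (hν : ν₀ ≠ ν₁) (hp : ∀ μ, μ ≠ ν₀ → p μ = 0) {g : ZMod (K ν₀) → ℝ}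
    (hg : 0 < ∑ j, g j ^ 2) :
    ∃ i, (isHermitian_covLapF K c m2 (fluxLink K p ν₁)).eigenvalues i
      ≤ m2 + c * ((∑ j, (g j - g (j + 1)) ^ 2 + ∑ j, (2 - 2 * ((ZMod.stdAddChar (N := K ν₀)) (p ν₀ * j) : ℂ).re) * g j ^ 2) / ∑ j, g j ^ 2) := by
  set v : Tor K × Unit → ℂ := fun z => ((g (z.1 ν₀) : ℝ) : ℂ) with hv
  have hT : (0 : ℝ) < Fintype.card (Tor K) := by exact_mod_cast Fintype.card_pos
  have hN : (0 : ℝ) < K ν₀ := by exact_mod_cast Nat.pos_of_ne_zero (NeZero.ne _)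
  -- the norm of the trial state
  have hnorm : (K ν₀ : ℝ) * ∑ z : Tor K × Unit, ‖v z‖ ^ 2 = (Fintype.card (Tor K) : ℝ) * ∑ j, g j ^ 2 := by
    rw [Fintype.sum_prod_type]
    simp only [Fintype.sum_unique, hv, Complex.norm_real, Real.norm_eq_abs, sq_abs]
    exact sum_comp_coord K ν₀ (fun j => g j ^ 2)
  have hvne : v ≠ 0 := by
    intro h0
    have : ∑ z : Tor K × Unit, ‖v z‖ ^ 2 = 0 := by rw [h0]; simp
    have h2 := hnorm
    rw [this, mul_zero] at h2
    have : ∑ j, g j ^ 2 = 0 := by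
      rcases mul_eq_zero.mp h2.symm with h | h
      · exact absurd h hT.ne'
      · exact h
    exact hg.ne' this
  obtain ⟨⟨i, hi⟩, -⟩ := Literature.LinearAlgebra.Matrix.RayleighQuotient.exists_eigenvalues_le_and_ge_re_form_div (isHermitian_covLapF K c m2 (fluxLink K p ν₁)) hvne
  refine ⟨i, hi.trans (le_of_eq ?_)⟩
  have hform := re_quadForm_covLapF_fluxLink_profile K c m2 hν hp g
  have hre : RCLike.re (star v ⬝ᵥ covLapF K c m2 (fluxLink K p ν₁) *ᵥ v) = (star v ⬝ᵥ (covLapF K c m2 (fluxLink K p ν₁) *ᵥ v)).re := rfl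
  rw [hre]
  have hS : 0 < ∑ z : Tor K × Unit, ‖v z‖ ^ 2 := by
    have h1 := mul_pos hT hg
    rw [← hnorm] at h1
    by_contra hle
    have hle' : ∑ z : Tor K × Unit, ‖v z‖ ^ 2 ≤ 0 := not_lt.mp hle
    nlinarith [mul_nonneg hN.le (sub_nonneg.mpr hle')]
  rw [div_eq_iff hS.ne', eq_comm]
  -- multiply through by `K_{ν₀}` and compare
  have h1 : (K ν₀ : ℝ) * ((star v ⬝ᵥ (covLapF K c m2 (fluxLink K p ν₁) *ᵥ v)).re) = (K ν₀ : ℝ) * ((m2 + c * ((∑ j, (g j - g (j + 1)) ^ 2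
      + ∑ j, (2 - 2 * ((ZMod.stdAddChar (N := K ν₀)) (p ν₀ * j) : ℂ).re) * g j ^ 2) / ∑ j, g j ^ 2)) * ∑ z : Tor K × Unit, ‖v z‖ ^ 2) := by
    rw [hform, ← mul_assoc, mul_comm (K ν₀ : ℝ), mul_assoc, hnorm]
    field_simp
  exact mul_left_cancel₀ hN.ne' h1.symm

end Profile

/-! ## §4 The tent trial: an eigenvalue `O(cθ)` above `m²`; the two-sided Landau scaling -/

section TwoSided

variable {d : ℕ} (K : Fin (d + 1) → ℕ) [hK : ∀ μ, NeZero (K μ)] {c : ℝ}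

/-- ★★★ **THE TENT BOUND**: for `p` supported on `ν₀ ≠ ν₁`, `c ≥ 0` and every width `1 ≤ ℓ ≤ K_{ν₀}∕2`, some eigenvalue of `−cΔ_U+m²` at `U = fluxLink p ν₁` is
`≤ m² + c·(9∕ℓ² + θ²ℓ²)`, `θ = p′_{ν₀}` (kinetic `(2ℓ+1)·3∕ℓ³ ≤ 9∕ℓ²`, potential `θ²ℓ²`). [cite: HornJohnson2013, Thm 4.2.2; King1986, (4.4) p.670, (2.12) p.653] -/
theorem exists_eigenvalue_covLapF_fluxLink_le_tent (hc : 0 ≤ c) (m2 : ℝ) {p : Tor K} {ν₀ ν₁ : Fin (d + 1)} (hν : ν₀ ≠ ν₁) (hp : ∀ μ, μ ≠ ν₀ → p μ = 0)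
    {ℓ : ℕ} (hℓ1 : 1 ≤ ℓ) (hℓ : ℓ ≤ K ν₀ / 2) :
    ∃ i, (isHermitian_covLapF K c m2 (fluxLink K p ν₁)).eigenvalues i ≤ m2 + c * (9 / (ℓ : ℝ) ^ 2 + (sOf K p ν₀) ^ 2 * (ℓ : ℝ) ^ 2) := by
  set g : ZMod (K ν₀) → ℝ := tent ℓ with hgdef
  have hℓpos : (0 : ℝ) < ℓ := by exact_mod_cast hℓ1
  have hmass : (ℓ : ℝ) ^ 3 / 3 ≤ ∑ j, g j ^ 2 := sum_tent_sq_ge hℓ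
  have hgpos : 0 < ∑ j, g j ^ 2 := lt_of_lt_of_le (by positivity) hmass
  have hθ : (ZMod.stdAddChar (N := K ν₀)) (p ν₀) = Complex.exp ((sOf K p ν₀ : ℝ) * Complex.I) := by rw [← chi_unitVec, chi_unitVec_eq_exp]
  have hkin : ∑ j, (g j - g (j + 1)) ^ 2 ≤ 2 * (ℓ : ℝ) + 1 := by
    have h := sum_tent_fwdDiff_sq_le (N := K ν₀) ℓ
    calc ∑ j, (g j - g (j + 1)) ^ 2 = ∑ j : ZMod (K ν₀), (tent ℓ (j + 1) - tent ℓ j) ^ 2 := Finset.sum_congr rfl fun j _ => by rw [hgdef]; ring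
      _ ≤ _ := h
  have hpot := sum_potential_tent_sq_le ℓ (p ν₀) hθ
  obtain ⟨i, hi⟩ := exists_eigenvalue_le_of_profile K c m2 hν hp hgpos
  refine ⟨i, hi.trans ?_⟩
  have hratio : (∑ j, (g j - g (j + 1)) ^ 2 + ∑ j, (2 - 2 * ((ZMod.stdAddChar (N := K ν₀)) (p ν₀ * j) : ℂ).re) * g j ^ 2) / ∑ j, g j ^ 2
      ≤ 9 / (ℓ : ℝ) ^ 2 + (sOf K p ν₀) ^ 2 * (ℓ : ℝ) ^ 2 := by
    rw [div_le_iff₀ hgpos]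
    have h9 : 2 * (ℓ : ℝ) + 1 ≤ 9 / (ℓ : ℝ) ^ 2 * ((ℓ : ℝ) ^ 3 / 3) := by
      rw [show 9 / (ℓ : ℝ) ^ 2 * ((ℓ : ℝ) ^ 3 / 3) = 3 * ℓ by field_simp; ring]
      have : (1 : ℝ) ≤ ℓ := by exact_mod_cast hℓ1
      linarith
    have h9' : 9 / (ℓ : ℝ) ^ 2 * ((ℓ : ℝ) ^ 3 / 3) ≤ 9 / (ℓ : ℝ) ^ 2 * ∑ j, g j ^ 2 := mul_le_mul_of_nonneg_left hmass (by positivity)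
    nlinarith [hkin, hpot, h9, h9']
  nlinarith [mul_le_mul_of_nonneg_left hratio hc]

/-- An integer window: for `0 < θ ≤ 1` with `θ·M² ≥ 4` there is `ℓ ∈ ℕ` with `1 ≤ ℓ ≤ M` and `1∕θ ≤ ℓ² ≤ 4∕θ` (take `ℓ = ⌈1∕√θ⌉`). [folklore] -/
theorem exists_nat_sq_window {θ : ℝ} (hθ0 : 0 < θ) (hθ1 : θ ≤ 1) {M : ℕ} (hM : 4 ≤ θ * (M : ℝ) ^ 2) :
    ∃ ℓ : ℕ, 1 ≤ ℓ ∧ ℓ ≤ M ∧ 1 / θ ≤ (ℓ : ℝ) ^ 2 ∧ (ℓ : ℝ) ^ 2 ≤ 4 / θ := by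
  set r : ℝ := Real.sqrt (1 / θ) with hr
  have hr1 : 1 ≤ r := by rw [hr, Real.le_sqrt (by norm_num) (by positivity)]; rw [one_pow, le_div_iff₀ hθ0]; linarith
  have hrsq : r ^ 2 = 1 / θ := Real.sq_sqrt (by positivity)
  refine ⟨⌈r⌉₊, ?_, ?_, ?_, ?_⟩
  · exact Nat.one_le_iff_ne_zero.mpr (by rw [Ne, Nat.ceil_eq_zero]; linarith)
  · -- `⌈r⌉ ≤ M` since `r + 1 ≤ 2r ≤ M` (`θM² ≥ 4 ⟹ M ≥ 2∕√θ = 2r`)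
    have hM' : 2 * r ≤ M := by
      have h4 : (2 * r) ^ 2 ≤ (M : ℝ) ^ 2 := by
        rw [mul_pow, hrsq, show (2 : ℝ) ^ 2 * (1 / θ) = 4 / θ by ring, div_le_iff₀ hθ0]
        linarith [mul_comm θ ((M : ℝ) ^ 2)]
      nlinarith [Nat.cast_nonneg (α := ℝ) M, sq_nonneg ((M : ℝ) - 2 * r)]
    have h := Nat.ceil_lt_add_one (by linarith : 0 ≤ r)
    have : (⌈r⌉₊ : ℝ) ≤ M := by linarith
    exact_mod_cast this
  · rw [← hrsq]; exact pow_le_pow_left₀ (by linarith) (Nat.le_ceil r) 2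
  · have h := Nat.ceil_lt_add_one (by linarith : 0 ≤ r)
    have h2 : ((⌈r⌉₊ : ℕ) : ℝ) ^ 2 ≤ (r + 1) ^ 2 := pow_le_pow_left₀ (Nat.cast_nonneg _) h.le 2
    calc ((⌈r⌉₊ : ℕ) : ℝ) ^ 2 ≤ (r + 1) ^ 2 := h2
      _ ≤ (2 * r) ^ 2 := pow_le_pow_left₀ (by linarith) (by linarith) 2
      _ = 4 / θ := by rw [mul_pow, hrsq]; ring

/-- ★★★ **AN EIGENVALUE `≤ m² + 13c·θ` AT SMALL FLUX**: for `p` supported on `ν₀ ≠ ν₁` with `0 < θ = p′_{ν₀} ≤ 1` and a long enough `ν₀`-cycle (`θ·(K_{ν₀}∕2)² ≥ 4`, automatic for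
`K_{ν₀} ≥ 6` since `θ ≥ 2π∕K_{ν₀}` — kept as an explicit hypothesis), `c ≥ 0`: some eigenvalue of `−cΔ_U+m²` at the flux field is `≤ m² + 13cθ`. [cite: HornJohnson2013, Thm 4.2.2; King1986, (4.4) p.670] -/
theorem exists_eigenvalue_covLapF_fluxLink_le_linear (hc : 0 ≤ c) (m2 : ℝ) {p : Tor K} {ν₀ ν₁ : Fin (d + 1)} (hν : ν₀ ≠ ν₁) (hp : ∀ μ, μ ≠ ν₀ → p μ = 0)
    (hθ0 : 0 < sOf K p ν₀) (hθ1 : sOf K p ν₀ ≤ 1) (hbig : 4 ≤ sOf K p ν₀ * ((K ν₀ / 2 : ℕ) : ℝ) ^ 2) :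
    ∃ i, (isHermitian_covLapF K c m2 (fluxLink K p ν₁)).eigenvalues i ≤ m2 + 13 * c * sOf K p ν₀ := by
  obtain ⟨ℓ, hℓ1, hℓM, hlo, hhi⟩ := exists_nat_sq_window hθ0 hθ1 hbig
  obtain ⟨i, hi⟩ := exists_eigenvalue_covLapF_fluxLink_le_tent K hc m2 hν hp hℓ1 hℓM
  refine ⟨i, hi.trans ?_⟩
  set θ := sOf K p ν₀ with hθ
  have hℓpos : (0 : ℝ) < (ℓ : ℝ) ^ 2 := by positivity
  have h1 : 9 / (ℓ : ℝ) ^ 2 ≤ 9 * θ := by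
    rw [div_le_iff₀ hℓpos]
    have := mul_le_mul_of_nonneg_left hlo (by norm_num : (0 : ℝ) ≤ 9)
    calc (9 : ℝ) = 9 * (1 / θ) * θ := by field_simp
      _ ≤ 9 * (ℓ : ℝ) ^ 2 * θ := by nlinarith
      _ = 9 * θ * (ℓ : ℝ) ^ 2 := by ring
  have h2 : θ ^ 2 * (ℓ : ℝ) ^ 2 ≤ 4 * θ := by
    calc θ ^ 2 * (ℓ : ℝ) ^ 2 ≤ θ ^ 2 * (4 / θ) := mul_le_mul_of_nonneg_left hhi (sq_nonneg _)
      _ = 4 * θ := by field_simp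
  nlinarith [mul_le_mul_of_nonneg_left (add_le_add h1 h2) hc]

/-- ★★★ **THE TWO-SIDED LANDAU SCALING**: in the setting of the previous theorem (`0 < θ ≤ 1`, `p = p₀e_{ν₀}`, long `ν₀`-cycle, `c ≥ 0`):
`m² + cθ∕4 ≤ λ_i` for EVERY eigenvalue (PART Ϡ-c) and `λ_i ≤ m² + 13cθ` for SOME eigenvalue — the curvature gap of King's covariant fine operator at constant flux is of EXACT ORDER `cθ`.
[cite: King1986, (4.4) p.670; HornJohnson2013, Thm 4.2.2] -/
theorem landau_two_sided (hc : 0 ≤ c) (m2 : ℝ) {p : Tor K} {ν₀ ν₁ : Fin (d + 1)} (hν : ν₀ ≠ ν₁) (hp : ∀ μ, μ ≠ ν₀ → p μ = 0)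
    (hθ0 : 0 < sOf K p ν₀) (hθ1 : sOf K p ν₀ ≤ 1) (hbig : 4 ≤ sOf K p ν₀ * ((K ν₀ / 2 : ℕ) : ℝ) ^ 2) :
    (∀ i, m2 + c * (sOf K p ν₀ / 4) ≤ (isHermitian_covLapF K c m2 (fluxLink K p ν₁)).eigenvalues i)
      ∧ ∃ i, (isHermitian_covLapF K c m2 (fluxLink K p ν₁)).eigenvalues i ≤ m2 + 13 * c * sOf K p ν₀ := by
  refine ⟨fun i => ?_, exists_eigenvalue_covLapF_fluxLink_le_linear K hc m2 hν hp hθ0 hθ1 hbig⟩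
  have h := eigenvalues_covLapF_fluxLink_ge_quarter K hc m2 hν (hp ν₁ (Ne.symm hν)) (by rw [abs_of_pos hθ0]; exact hθ1) i
  rwa [abs_of_pos hθ0] at h

end TwoSided

end Summit.QuantumFields.YangMills.BalabanUVNodes.N15KingModelRung.Landau

end
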